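import Literature.MathematicalPhysics.QuantumFieldTheory.Balaban1983to89.Node00.Record13NumericsOfThm1CCMZ
import Literature.MathematicalPhysics.QuantumFieldTheory.Balaban1983to89.Node00.Record13LiveSelectorChi

/-!
# NODE 00 — OP 5a (dag-lead g40 HANDS-3 H3.1, director-ym №478): THE ALL-NUMERICS WITNESS FAMILY WITH THE LETTERS IN THE χ SLOT —
# `theta13LiveOfNumericsZChi n ε₂₉ ζ Rz Zt Efl logz χ := (theta13OfNumericsZ …).liveRepin₁₃Chi χ` — its faces and rows G ∕ Z ∕ P12 ∕ `HasResidualsOfRecord` ∕ `Provisos₁₃Chi`-from-P11,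
# receipts at the record's own slot (`rfl`) and the re-centred instance `theta13LiveOfNumericsZAx` (χ-generic edition of exactly the centred declarations of
# `Node00/Record13NumericsOfThm1CCMZ` §1 in dag-n07-w3 g22's σ-closure of the K0 V23 door, `SIGMA-CLOSURE-K0-V23-Ax.g22.md` 4ca252f7ab47910a; NEW names only)

Cell `pub-ymgap`, seat `pub-ymgap-node00-def-Y` (g34; Node00 custodian ∕ definer), count-neutral.  [I] = [Balaban1987RG1], [III] = [Balaban1988Convergent],
[IV] = [Balaban1989LargeFieldI], [V] = [Balaban1989LargeFieldII].  σ-recipe of [Ax-3b] `Node00/Record13Chi`; bottom layer = this seat's `Node00/Record13LiveSelectorChi`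
(`Stage13Params.liveRepin₁₃Chi θ χ`).

WHY (dag-n07-w3 g22 FINDING 1; this seat's supply map 2026-08-31).  «Z2»'s `theta13LiveOfNumericsZ n ε₂₉ ζ Rz Zt Efl logz := (theta13OfNumericsZ …).liveRepin₁₃` is CENTRED through
the re-pin only: the identity-selector member `theta13OfNumericsZ` reads no β-slot (centre-free, CITED here, not re-issued).  DEF-1's door constructor `theta13OfThm1CCMWZB` (V23's
`θ`) is `theta13LiveOfNumericsZ` at the B numerics, so its χ∕Ax edition (this seat's next file `Record13NumericsOfThm1CCMWZBChi`) needs THIS family first; seat node00-def-RR-2's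
socket file F8 (`Record13SepCoPLiveSelectorZChi`) keys on it too.

WHAT THIS FILE DECLARES (token for token against `Record13NumericsOfThm1CCMZ` :104–:185):
* §1 `theta13LiveOfNumericsZChi … χ` + `rfl` faces `_eq ∕ _toStage8Params ∕ _Efl ∕ _logz ∕ _ν ∕ _γ ∕ _ε₂₉ ∕ _τ9 ∕ _s2 ∕ _A₁ ∕ _Rz ∕ _Zt ∕ _ppSel`, the slot faces
  `chiβOfRecord₁₃_∕chiβOfRecord₁₃Ax_theta13LiveOfNumericsZChi` (`rfl`), `eight_le_L_…`, and the rows `admissible_theta13LiveOfNumericsZ_chi` (row G ⟸ `n.Pos ∧ 0 < ε₂₉`),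
  `hasResidualsOfRecord_…_chi` (`⟨rfl, rfl, rfl⟩`), `ztUnity_…_chi`, ★ `slotsNondegenerate₁₃_theta13LiveOfNumericsZ_chi` (from `Provisos₁₃Chi` there), ★★ `…_of_hasResiduals_chi`
  (HYPOTHESIS-FREE), ★ `provisos₁₃_theta13LiveOfNumericsZ_of_bg_chi` (from row P11 alone; `bg` DISPLAYED) — all by the θ-generic χ rows of `Record13LiveSelectorChi`.
* §R receipts (`rfl`): `theta13LiveOfNumericsZChi_chiβ : theta13LiveOfNumericsZChi … (chiβOfRecord₁₃ F N (theta13OfNumericsZ …)) = theta13LiveOfNumericsZ …` and the closed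
  form `theta13LiveOfNumericsZChi_chiFixed29` (at `χ := chiFixed29 F N n.ν ε₂₉`).
* §A the re-centred instance OF THE SAME ARITY AS THE BARE NAME: `abbrev theta13LiveOfNumericsZAx n ε₂₉ ζ Rz Zt Efl logz := theta13LiveOfNumericsZChi … (chiβOfRecord₁₃Ax F N
  (theta13OfNumericsZ …))` (= `(theta13OfNumericsZ …).liveRepin₁₃Ax`, `rfl`; its β-slot is `chiFixed29Ax F N n.ν ε₂₉`, `rfl`) with the row instances `admissible_theta13LiveOfNumericsZAx`,
  `hasResidualsOfRecord_∕ztUnity_theta13LiveOfNumericsZAx`, `slotsNondegenerate₁₃Ax_theta13LiveOfNumericsZAx_of_hasResiduals` — dag-n07-w3's H3.3 σ is then a token map.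

HONEST FRAMING.  A definition edition in the χ slot + `rfl` views + instantiation BY NAME of this seat's θ-generic χ rows; NO closed value of `E_k`, `log z_k` or of χ is pinned
for anybody; nothing of Bałaban's asserted, ported or discharged; the P11 `bg` row stays DISPLAYED; K0ᴬ stmt-QuantumFields-27238 ∕ K1ᴬ 27239 ∕ K3ᴬ 27247 OPEN (door supply only;
K2ᴬ 27246 proved by name); COUNT 8∕28 · K 1∕4 of record UNMOVED; one finite 𝕋⁴ programme at fixed `ε = L^{-K}` — NOT continuum ∕ ℝ⁴ ∕ OS; the Yang–Mills mass gap (Clay) is NOT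
proved by any of this.  No `sorry`, no `axiom`, no `instance`, no `notation`; standard axioms only.
-/

noncomputable section

open MeasureTheory
open scoped Matrix.Norms.L2Operator

namespace Literature.MathematicalPhysics.QuantumFieldTheory.Balaban1983to89.Node00

open T4Continuum AveragingRT T4FiniteEpsInhabited FlowStep FlowStepRuns DagBinding T4DatumAssembly B4GaugeCovariance

/-! ## §1. The all-numerics live family with the letters IN THE χ SLOT: `theta13LiveOfNumericsZChi` -/

section AllNumericsZChi

variable (F : T4Family) (N : ℕ) [NeZero N] (n : Stage12Numerics) (ε₂₉ : ℝ)
variable (ζ : ZetaOfRecord F N n.ν n.τ9.M) (Rz : (K : ℕ) → Sect2.Residual (F.P K) (MatA N)) (Zt : (K : ℕ) → TkResidualW F N (FluctV N) K)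
variable (Efl logz : B12.RunParams → ℕ → ℝ) (χ : ChiSlot F N)

/-- **THE ALL-NUMERICS WITNESS FAMILY WITH THE LETTERS, IN THE χ SLOT** `θ₁₃ᶻ(n, ε₂₉; Efl, logz; χ) := θᶻ(n, ε₂₉; Efl, logz).liveRepin₁₃Chi χ`: «Z2»'s `theta13LiveOfNumericsZ`
(:104) with the live re-pin read through the β-slot `χ` (the identity-selector member `theta13OfNumericsZ` is centre-free and cited).  At `χ := chiβOfRecord₁₃ (theta13OfNumericsZ …)`
it IS `theta13LiveOfNumericsZ …` (`theta13LiveOfNumericsZChi_chiβ`, `rfl`). [cite: Balaban1989LargeFieldI, (0.3) p.176 and p.177; Balaban1987RG1, (2.9) p.266 (bookkeeping witness)] -/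
def theta13LiveOfNumericsZChi : Stage13Params F N :=
  (theta13OfNumericsZ F N n ε₂₉ ζ Rz Zt Efl logz).liveRepin₁₃Chi F N χ

/-- Unfolding (`rfl`). [cite: Balaban1989LargeFieldI, (0.3) p.176 (bookkeeping)] -/
theorem theta13LiveOfNumericsZChi_eq :
    theta13LiveOfNumericsZChi F N n ε₂₉ ζ Rz Zt Efl logz χ = (theta13OfNumericsZ F N n ε₂₉ ζ Rz Zt Efl logz).liveRepin₁₃Chi F N χ := rfl

/-- FACE (`rfl`): the Stage-8 part is the identity-selector member's. [cite: Balaban1987RG1, (0.21) p.256 (bookkeeping)] -/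
theorem theta13LiveOfNumericsZChi_toStage8Params :
    (theta13LiveOfNumericsZChi F N n ε₂₉ ζ Rz Zt Efl logz χ).toStage8Params = (theta13OfNumericsZ F N n ε₂₉ ζ Rz Zt Efl logz).toStage8Params := rfl

/-- FACE (`rfl`): the `Efl` letter (the χ re-pin changes the selector only). [cite: Balaban1988Convergent, (1.15) p.249 (bookkeeping)] -/
theorem theta13LiveOfNumericsZChi_Efl : (theta13LiveOfNumericsZChi F N n ε₂₉ ζ Rz Zt Efl logz χ).Efl = Efl := rfl

/-- FACE (`rfl`): the `logz` letter. [cite: Balaban1989LargeFieldII, (0.15) p.360 (bookkeeping)] -/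
theorem theta13LiveOfNumericsZChi_logz : (theta13LiveOfNumericsZChi F N n ε₂₉ ζ Rz Zt Efl logz χ).logz = logz := rfl

/-- FACE (`rfl`): numerics. [cite: Balaban1988Convergent, (2.4) p.255 (bookkeeping)] -/
theorem theta13LiveOfNumericsZChi_ν : (theta13LiveOfNumericsZChi F N n ε₂₉ ζ Rz Zt Efl logz χ).ν = n.ν := rfl

/-- FACE (`rfl`): window. [cite: Balaban1987RG1, Thm 1 p.259 (bookkeeping)] -/
theorem theta13LiveOfNumericsZChi_γ : (theta13LiveOfNumericsZChi F N n ε₂₉ ζ Rz Zt Efl logz χ).γ = n.γ := rfl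

/-- FACE (`rfl`): (2.9) letter. [cite: Balaban1987RG1, (2.9) p.266 (bookkeeping)] -/
theorem theta13LiveOfNumericsZChi_ε₂₉ : (theta13LiveOfNumericsZChi F N n ε₂₉ ζ Rz Zt Efl logz χ).ε₂₉ = ε₂₉ := rfl

/-- FACE (`rfl`): tower numerics. [cite: Balaban1988Convergent, (2.10) p.256 (bookkeeping)] -/
theorem theta13LiveOfNumericsZChi_τ9 : (theta13LiveOfNumericsZChi F N n ε₂₉ ζ Rz Zt Efl logz χ).τ9 = n.τ9 := rfl

/-- FACE (`rfl`): §2 numerics. [cite: Balaban1988Convergent, (2.28) p.259 (bookkeeping)] -/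
theorem theta13LiveOfNumericsZChi_s2 : (theta13LiveOfNumericsZChi F N n ε₂₉ ζ Rz Zt Efl logz χ).s2 = n.s2 := rfl

/-- FACE (`rfl`): `A₁`. [cite: Balaban1987RG1, (1.16) p.262 (bookkeeping)] -/
theorem theta13LiveOfNumericsZChi_A₁ : (theta13LiveOfNumericsZChi F N n ε₂₉ ζ Rz Zt Efl logz χ).A₁ = n.A₁ := rfl

/-- FACE (`rfl`): `ζ`. [cite: Balaban1988Convergent, (3.16) p.268 (bookkeeping)] -/
theorem theta13LiveOfNumericsZChi_ζ : (theta13LiveOfNumericsZChi F N n ε₂₉ ζ Rz Zt Efl logz χ).ζ = ζ := rfl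

/-- FACE (`rfl`): `Rz`. [cite: Balaban1988Convergent, (2.21) p.258 (bookkeeping)] -/
theorem theta13LiveOfNumericsZChi_Rz : (theta13LiveOfNumericsZChi F N n ε₂₉ ζ Rz Zt Efl logz χ).Rz = Rz := rfl

/-- FACE (`rfl`): `Zt`. [cite: Balaban1988Convergent, (3.20) p.269 (bookkeeping)] -/
theorem theta13LiveOfNumericsZChi_Zt : (theta13LiveOfNumericsZChi F N n ε₂₉ ζ Rz Zt Efl logz χ).Zt = Zt := rfl

/-- FACE (`rfl`): the selector IS the live selector of record along the χ-generic ₁₃ plugs of the identity-selector member. [cite: Balaban1989LargeFieldI, (0.3) p.176 (bookkeeping)] -/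
theorem theta13LiveOfNumericsZChi_ppSel :
    (theta13LiveOfNumericsZChi F N n ε₂₉ ζ Rz Zt Efl logz χ).ppSel =
      ppSelLiveOfRecord F N n.ν n.τ9 (EOfRecord₁₃Chi F N (theta13OfNumericsZ F N n ε₂₉ ζ Rz Zt Efl logz) χ)
        (wOfRecord₉ F N (theta13OfNumericsZ F N n ε₂₉ ζ Rz Zt Efl logz).toStage9Params) := rfl

/-- FACE (`rfl`): the record's own β-slot of the χ member is the identity-selector member's, i.e. `chiFixed29 F N n.ν ε₂₉`. [cite: Balaban1987RG1, (2.9) p.266 (bookkeeping)] -/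
theorem chiβOfRecord₁₃_theta13LiveOfNumericsZChi :
    chiβOfRecord₁₃ F N (theta13LiveOfNumericsZChi F N n ε₂₉ ζ Rz Zt Efl logz χ) = chiFixed29 F N n.ν ε₂₉ := rfl

/-- FACE (`rfl`): the re-centred β-slot of the χ member is `chiFixed29Ax F N n.ν ε₂₉`. [cite: Balaban1987RG1, (2.9) p.266, p.265 (2.3) (bookkeeping)] -/
theorem chiβOfRecord₁₃Ax_theta13LiveOfNumericsZChi :
    chiβOfRecord₁₃Ax F N (theta13LiveOfNumericsZChi F N n ε₂₉ ζ Rz Zt Efl logz χ) = chiFixed29Ax F N n.ν ε₂₉ := rfl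

/-- N10's Lemma-3 level-T binder at every χ member: `8 ≤ θ.ℓ₆ + 1`. [cite: Balaban1987RG1, (0.1) p.251; Balaban1988RG2Cluster, (2.36) p.19] -/
theorem eight_le_L_theta13LiveOfNumericsZChi : 8 ≤ (theta13LiveOfNumericsZChi F N n ε₂₉ ζ Rz Zt Efl logz χ).ℓ₆ + 1 := eight_le_L_stage3OfFamily F

/-- FACE: `ℓ₆ + 1 = L`. [cite: Balaban1987RG1, (0.1) p.251 (bookkeeping)] -/
theorem theta13LiveOfNumericsZChi_ℓ₆_succ : (theta13LiveOfNumericsZChi F N n ε₂₉ ζ Rz Zt Efl logz χ).ℓ₆ + 1 = F.L := stage3OfFamily_ℓ₆_succ F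

variable {n ε₂₉} in
/-- **Row G at every χ member: Admissible ⟸ `n.Pos` ∧ `0 < ε₂₉`** (letter- and χ-blind). [cite: Balaban1987RG1, (0.21) p.256, (2.9) p.266; Balaban1988Convergent, (2.10) p.256 (bookkeeping)] -/
theorem admissible_theta13LiveOfNumericsZ_chi (hn : n.Pos) (hε' : 0 < ε₂₉) : (theta13LiveOfNumericsZChi F N n ε₂₉ ζ Rz Zt Efl logz χ).Admissible F N :=
  (admissible_theta13OfNumericsZ F N ζ Rz Zt Efl logz hn hε').liveRepin₁₃Chi

/-- At K0b's residuals every χ member carries them (`⟨rfl, rfl, rfl⟩`). [cite: Balaban1988Convergent, (3.16) p.268, (2.21) p.258, (3.20) p.269 (bookkeeping)] -/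
theorem hasResidualsOfRecord_theta13LiveOfNumericsZ_chi :
    (theta13LiveOfNumericsZChi F N n ε₂₉ (zeta316OfRecord F N n.ν n.τ9.M n.A₁) (RzOfRecord F N) (ZtOfRecord F N) Efl logz χ).HasResidualsOfRecord F N :=
  ⟨rfl, rfl, rfl⟩

/-- **Row Z (`ZtUnity`) at every χ member carrying K0b's residuals.** [cite: Balaban1988Convergent, (3.16)–(3.20) pp.268–269] -/
theorem ztUnity_theta13LiveOfNumericsZ_chi :
    (theta13LiveOfNumericsZChi F N n ε₂₉ (zeta316OfRecord F N n.ν n.τ9.M n.A₁) (RzOfRecord F N) (ZtOfRecord F N) Efl logz χ).ZtUnity F N :=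
  (hasResidualsOfRecord_theta13LiveOfNumericsZ_chi F N n ε₂₉ Efl logz χ).ztUnity

/-- **★ Row P12 (`SlotsNondegenerate₁₃Chi`) at every χ member from `Provisos₁₃Chi` there** (the θ-generic `slotsNondegenerate₁₃_liveRepin_chi`).
[cite: Balaban1988Convergent, (3.22) p.269, (3.24) p.270; Balaban1989LargeFieldI, (0.3)–(0.4) p.176] -/
theorem slotsNondegenerate₁₃_theta13LiveOfNumericsZ_chi (h : (theta13LiveOfNumericsZChi F N n ε₂₉ ζ Rz Zt Efl logz χ).Provisos₁₃Chi F N χ) :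
    (theta13LiveOfNumericsZChi F N n ε₂₉ ζ Rz Zt Efl logz χ).SlotsNondegenerate₁₃Chi F N χ :=
  Stage13Params.slotsNondegenerate₁₃_liveRepin_chi F N (theta13OfNumericsZ F N n ε₂₉ ζ Rz Zt Efl logz) χ h

/-- **★★ Row P12 at every χ member carrying K0b's residuals — HYPOTHESIS-FREE, LETTER- AND χ-GENERIC** (the θ-generic `slotsNondegenerate₁₃_liveRepin_of_hasResiduals_chi`; no proviso,
no letter, no value of χ read). [cite: Balaban1988Convergent, (3.22) p.269; Balaban1989LargeFieldI, (0.3)–(0.4) p.176 (bookkeeping)] -/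
theorem slotsNondegenerate₁₃_theta13LiveOfNumericsZ_of_hasResiduals_chi :
    (theta13LiveOfNumericsZChi F N n ε₂₉ (zeta316OfRecord F N n.ν n.τ9.M n.A₁) (RzOfRecord F N) (ZtOfRecord F N) Efl logz χ).SlotsNondegenerate₁₃Chi F N χ :=
  Stage13Params.slotsNondegenerate₁₃_liveRepin_of_hasResiduals_chi (θ := theta13OfNumericsZ F N n ε₂₉ _ _ _ Efl logz)
    (hasResidualsOfRecord_theta13OfNumericsZ F N n ε₂₉ Efl logz)

/-- **★ `Provisos₁₃Chi` at every χ member carrying K0b's residuals FROM ROW P11 ALONE** (the θ-generic `provisos₁₃_liveRepin₁₃_of_bg_chi`; (H-U) by K0c's `localBgMeasurable`);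
the `bg` row stays DISPLAYED. [cite: Balaban1988Convergent, (2.18) p.257, (2.28) p.259, (3.16) p.268, (3.22) p.269; Balaban1989LargeFieldI, (0.3)–(0.4) p.176 (bookkeeping)] -/
theorem provisos₁₃_theta13LiveOfNumericsZ_of_bg_chi
    (hbg : ∀ (p : B12.RunParams) (m : ℕ), m ≤ p.K →
      Step.InInterval (theta13OfNumericsZ F N n ε₂₉ (zeta316OfRecord F N n.ν n.τ9.M n.A₁) (RzOfRecord F N) (ZtOfRecord F N) Efl logz).γ m
        (gOfRecord₁₃Chi F N (theta13OfNumericsZ F N n ε₂₉ (zeta316OfRecord F N n.ν n.τ9.M n.A₁) (RzOfRecord F N) (ZtOfRecord F N) Efl logz) χ p) →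
      BgProvisoΛ F N p.K
        (settingOfRecord₁₃Chi F N (theta13LiveOfNumericsZChi F N n ε₂₉ (zeta316OfRecord F N n.ν n.τ9.M n.A₁) (RzOfRecord F N) (ZtOfRecord F N) Efl logz χ) χ p)
        (RzOfRecord F N p.K) n.τ9.M m
        (suppOfRecord₁₃Chi F N (theta13LiveOfNumericsZChi F N n ε₂₉ (zeta316OfRecord F N n.ν n.τ9.M n.A₁) (RzOfRecord F N) (ZtOfRecord F N) Efl logz χ) χ p m)
        (UbgOfRecord₁₃Chi F N (theta13LiveOfNumericsZChi F N n ε₂₉ (zeta316OfRecord F N n.ν n.τ9.M n.A₁) (RzOfRecord F N) (ZtOfRecord F N) Efl logz χ) χ p m)) :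
    (theta13LiveOfNumericsZChi F N n ε₂₉ (zeta316OfRecord F N n.ν n.τ9.M n.A₁) (RzOfRecord F N) (ZtOfRecord F N) Efl logz χ).Provisos₁₃Chi F N χ :=
  (theta13OfNumericsZ F N n ε₂₉ _ _ _ Efl logz).provisos₁₃_liveRepin₁₃_of_bg_chi (hasResidualsOfRecord_theta13OfNumericsZ F N n ε₂₉ Efl logz) hbg

end AllNumericsZChi

/-! ## §R. RECEIPTS AT THE RECORD'S OWN SLOT: the χ family at `χ := chiβOfRecord₁₃ (theta13OfNumericsZ …)` IS «Z2»'s `theta13LiveOfNumericsZ` (`rfl`) -/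

section Receipts

variable {F : T4Family} {N : ℕ} [NeZero N] (n : Stage12Numerics) (ε₂₉ : ℝ)
variable (ζ : ZetaOfRecord F N n.ν n.τ9.M) (Rz : (K : ℕ) → Sect2.Residual (F.P K) (MatA N)) (Zt : (K : ℕ) → TkResidualW F N (FluctV N) K)
variable (Efl logz : B12.RunParams → ℕ → ℝ)

/-- `theta13LiveOfNumericsZChi … (chiβOfRecord₁₃ θᶻ) = theta13LiveOfNumericsZ …` (`rfl`). [cite: Balaban1989LargeFieldI, (0.3) p.176 (bookkeeping)] -/
theorem theta13LiveOfNumericsZChi_chiβ :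
    theta13LiveOfNumericsZChi F N n ε₂₉ ζ Rz Zt Efl logz (chiβOfRecord₁₃ F N (theta13OfNumericsZ F N n ε₂₉ ζ Rz Zt Efl logz)) =
      theta13LiveOfNumericsZ F N n ε₂₉ ζ Rz Zt Efl logz := rfl

/-- … in closed form: at `χ := chiFixed29 F N n.ν ε₂₉` the χ member IS «Z2»'s member (`rfl`). [cite: Balaban1987RG1, (2.9) p.266 (bookkeeping)] -/
theorem theta13LiveOfNumericsZChi_chiFixed29 :
    theta13LiveOfNumericsZChi F N n ε₂₉ ζ Rz Zt Efl logz (chiFixed29 F N n.ν ε₂₉) = theta13LiveOfNumericsZ F N n ε₂₉ ζ Rz Zt Efl logz := rfl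

/-- Row P12 in the χ slot at the record's own slot IS «Z2»'s row P12 (`Iff.rfl`). [cite: Balaban1988Convergent, (3.22) p.269 (bookkeeping)] -/
theorem slotsNondegenerate₁₃Chi_theta13LiveOfNumericsZChi_chiβ_iff :
    (theta13LiveOfNumericsZChi F N n ε₂₉ ζ Rz Zt Efl logz (chiFixed29 F N n.ν ε₂₉)).SlotsNondegenerate₁₃Chi F N (chiFixed29 F N n.ν ε₂₉) ↔
      (theta13LiveOfNumericsZ F N n ε₂₉ ζ Rz Zt Efl logz).SlotsNondegenerate₁₃ F N := Iff.rfl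

end Receipts

/-! ## §A. THE RE-CENTRED INSTANCE `theta13LiveOfNumericsZAx` (same arity as the bare name; β-slot `chiFixed29Ax F N n.ν ε₂₉`) and its rows -/

section Ax

variable (F : T4Family) (N : ℕ) [NeZero N] (n : Stage12Numerics) (ε₂₉ : ℝ)
variable (ζ : ZetaOfRecord F N n.ν n.τ9.M) (Rz : (K : ℕ) → Sect2.Residual (F.P K) (MatA N)) (Zt : (K : ℕ) → TkResidualW F N (FluctV N) K)
variable (Efl logz : B12.RunParams → ℕ → ℝ)

/-- **THE ALL-NUMERICS WITNESS FAMILY WITH THE LETTERS, RE-CENTRED**: the χ family at the identity-selector member's re-centred β-slot `chiβOfRecord₁₃Ax (theta13OfNumericsZ …) =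
chiFixed29Ax F N n.ν ε₂₉` — i.e. `(theta13OfNumericsZ …).liveRepin₁₃Ax` (`rfl`). [cite: Balaban1989LargeFieldI, (0.3) p.176; Balaban1987RG1, (2.9) p.266, p.265 (2.3) (bookkeeping witness)] -/
abbrev theta13LiveOfNumericsZAx : Stage13Params F N :=
  theta13LiveOfNumericsZChi F N n ε₂₉ ζ Rz Zt Efl logz (chiβOfRecord₁₃Ax F N (theta13OfNumericsZ F N n ε₂₉ ζ Rz Zt Efl logz))

/-- `theta13LiveOfNumericsZAx … = (theta13OfNumericsZ …).liveRepin₁₃Ax` (`rfl`). [cite: Balaban1989LargeFieldI, (0.3) p.176 (bookkeeping)] -/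
theorem theta13LiveOfNumericsZAx_eq_liveRepin₁₃Ax :
    theta13LiveOfNumericsZAx F N n ε₂₉ ζ Rz Zt Efl logz = (theta13OfNumericsZ F N n ε₂₉ ζ Rz Zt Efl logz).liveRepin₁₃Ax F N := rfl

/-- … in closed form: the re-centred member is the χ member at `chiFixed29Ax F N n.ν ε₂₉` (`rfl`). [cite: Balaban1987RG1, (2.9) p.266 (bookkeeping)] -/
theorem theta13LiveOfNumericsZAx_eq_chi :
    theta13LiveOfNumericsZAx F N n ε₂₉ ζ Rz Zt Efl logz = theta13LiveOfNumericsZChi F N n ε₂₉ ζ Rz Zt Efl logz (chiFixed29Ax F N n.ν ε₂₉) := rfl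

/-- The re-centred member keeps its re-centred β-slot: `chiβOfRecord₁₃Ax (θᶻᴬˣ) = chiFixed29Ax F N n.ν ε₂₉` (`rfl`). [cite: Balaban1987RG1, (2.9) p.266 (bookkeeping)] -/
theorem chiβOfRecord₁₃Ax_theta13LiveOfNumericsZAx :
    chiβOfRecord₁₃Ax F N (theta13LiveOfNumericsZAx F N n ε₂₉ ζ Rz Zt Efl logz) = chiFixed29Ax F N n.ν ε₂₉ := rfl

/-- FACE (`rfl`): numerics. [cite: Balaban1988Convergent, (2.4) p.255 (bookkeeping)] -/
theorem theta13LiveOfNumericsZAx_ν : (theta13LiveOfNumericsZAx F N n ε₂₉ ζ Rz Zt Efl logz).ν = n.ν := rfl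

/-- FACE (`rfl`): window. [cite: Balaban1987RG1, Thm 1 p.259 (bookkeeping)] -/
theorem theta13LiveOfNumericsZAx_γ : (theta13LiveOfNumericsZAx F N n ε₂₉ ζ Rz Zt Efl logz).γ = n.γ := rfl

/-- FACE (`rfl`): (2.9) letter. [cite: Balaban1987RG1, (2.9) p.266 (bookkeeping)] -/
theorem theta13LiveOfNumericsZAx_ε₂₉ : (theta13LiveOfNumericsZAx F N n ε₂₉ ζ Rz Zt Efl logz).ε₂₉ = ε₂₉ := rfl

/-- FACE (`rfl`): `Efl`. [cite: Balaban1988Convergent, (1.15) p.249 (bookkeeping)] -/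
theorem theta13LiveOfNumericsZAx_Efl : (theta13LiveOfNumericsZAx F N n ε₂₉ ζ Rz Zt Efl logz).Efl = Efl := rfl

/-- FACE (`rfl`): `logz`. [cite: Balaban1989LargeFieldII, (0.15) p.360 (bookkeeping)] -/
theorem theta13LiveOfNumericsZAx_logz : (theta13LiveOfNumericsZAx F N n ε₂₉ ζ Rz Zt Efl logz).logz = logz := rfl

variable {n ε₂₉} in
/-- **Row G at the re-centred member ⟸ `n.Pos ∧ 0 < ε₂₉`.** [cite: Balaban1987RG1, (0.21) p.256, (2.9) p.266 (bookkeeping)] -/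
theorem admissible_theta13LiveOfNumericsZAx (hn : n.Pos) (hε' : 0 < ε₂₉) : (theta13LiveOfNumericsZAx F N n ε₂₉ ζ Rz Zt Efl logz).Admissible F N :=
  admissible_theta13LiveOfNumericsZ_chi F N ζ Rz Zt Efl logz _ hn hε'

/-- At K0b's residuals the re-centred member carries them. [cite: Balaban1988Convergent, (3.16) p.268, (2.21) p.258, (3.20) p.269 (bookkeeping)] -/
theorem hasResidualsOfRecord_theta13LiveOfNumericsZAx :
    (theta13LiveOfNumericsZAx F N n ε₂₉ (zeta316OfRecord F N n.ν n.τ9.M n.A₁) (RzOfRecord F N) (ZtOfRecord F N) Efl logz).HasResidualsOfRecord F N :=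
  ⟨rfl, rfl, rfl⟩

/-- **Row Z at the re-centred member carrying K0b's residuals.** [cite: Balaban1988Convergent, (3.16)–(3.20) pp.268–269] -/
theorem ztUnity_theta13LiveOfNumericsZAx :
    (theta13LiveOfNumericsZAx F N n ε₂₉ (zeta316OfRecord F N n.ν n.τ9.M n.A₁) (RzOfRecord F N) (ZtOfRecord F N) Efl logz).ZtUnity F N :=
  (hasResidualsOfRecord_theta13LiveOfNumericsZAx F N n ε₂₉ Efl logz).ztUnity

/-- **★★ Row P12 (`SlotsNondegenerate₁₃Ax`) at the re-centred member carrying K0b's residuals — HYPOTHESIS-FREE.** [cite: Balaban1988Convergent, (3.22) p.269; Balaban1989LargeFieldI, (0.3)–(0.4) p.176 (bookkeeping)] -/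
theorem slotsNondegenerate₁₃Ax_theta13LiveOfNumericsZAx_of_hasResiduals :
    (theta13LiveOfNumericsZAx F N n ε₂₉ (zeta316OfRecord F N n.ν n.τ9.M n.A₁) (RzOfRecord F N) (ZtOfRecord F N) Efl logz).SlotsNondegenerate₁₃Ax F N :=
  slotsNondegenerate₁₃_theta13LiveOfNumericsZ_of_hasResiduals_chi F N n ε₂₉ Efl logz _

/-- **★ Row P12 at the re-centred member from `Provisos₁₃Ax` there.** [cite: Balaban1988Convergent, (3.22) p.269, (3.24) p.270 (bookkeeping)] -/
theorem slotsNondegenerate₁₃Ax_theta13LiveOfNumericsZAx (h : (theta13LiveOfNumericsZAx F N n ε₂₉ ζ Rz Zt Efl logz).Provisos₁₃Ax F N) :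
    (theta13LiveOfNumericsZAx F N n ε₂₉ ζ Rz Zt Efl logz).SlotsNondegenerate₁₃Ax F N :=
  slotsNondegenerate₁₃_theta13LiveOfNumericsZ_chi F N n ε₂₉ ζ Rz Zt Efl logz _ h

end Ax

end Literature.MathematicalPhysics.QuantumFieldTheory.Balaban1983to89.Node00

end
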